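import Summits.QuantumFields.YangMills.Theorems.SwapVirialDeficitSectorLaplaceEndGaussShellSide
import HarnessLib

/-!
# STUB (S-end-G♭) OF SKELETON ➎, SHELL SIDE (δ) IN LEAD's INTERFACE SHAPE (I1)–(I4): ray identity from the fibre form, ball-constancy of `D`, and the shell inequality for
# `D p := ofReal((√det AF(gnoBase p))⁻¹)`
# (free-hands support of ⟨stmt-QuantumFields-24197⟩ `SwapVirialDeficit.SwapGluedStiffness`; cell ym-idea-1, LEAD g99 23:05Z INTERFACE RULING; assembler fcl-p3 g48)

* `folRay_of_fibreForm` — (I1) gives the reference family `AF` by `(hFs, hFyy, hamb)`; the ray identity used by ✓`gnoFolHessian_coercive_base` follows from `hFyy`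
  (✓`iteratedFDeriv_two_eq_lineJet` ∘ ✓`gnoDeficit_fol_ray`), so no fourth hypothesis is needed;
* ★ `norm_gnoBase_sub_le` (`‖gnoBase p − gnoBase p′‖ ≤ dist p p′`, sup metrics) and ★★ `D_ball_const` — (I4): `dist p p′ < μ_F∕(3|Fol L|·44712000·L⁴) ⟹
  ofReal((√det AF(gnoBase p))⁻¹) ≤ ofReal(e) · ofReal((√det AF(gnoBase p′))⁻¹)` (✓`abs_log_det_gnoFolHessian_sub_le_joint` at ONE hub `θ = θ′`, base coercivity §1 of ✓`…ShellPoint`);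
* ★★★ `endGauss_shell_ge_D` — ✓`endGauss_shell_ge` restated with (I1)'s hypotheses and (I2)'s integrand `D p * ofReal((1+x₀²)⁻¹(1+y₀²)⁻¹)`.

HONEST LABEL: interface bookkeeping for the shell side of `stub_end_gaussCore`; N2, comparison, assembly, `stub_core_tip`, ⟨24197⟩ ∕ ⟨24194⟩ OPEN; item of record ⟨24085⟩ aside ∕
untouched; the Yang–Mills mass gap is NOT proved; no summit is proved by a line.  THEOREMS ONLY (0 `def`, 0 `sorry`), standard axioms, no instances.  Seat ym-line-fcl-p3 g48,
`--supports stmt-QuantumFields-24197`.  References: [cite: Luscher1983, §2]; [cite: Breitung1994, Lemma 26]; [folklore].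
-/

set_option autoImplicit false
set_option synthInstance.maxSize 1024

noncomputable section

open MeasureTheory Quaternion Set Module Metric
open scoped Quaternion BigOperators ENNReal InnerProductSpace
open Literature.MathematicalPhysics.QuantumLattice
open Literature.MathematicalPhysics.QuantumFieldTheory hiding SU2

namespace Summit.QuantumFields.YangMills.Theorems.SwapVirialDeficit.SectorLaplace

open Summit.QuantumFields.YangMills.Theorems.FemtoTransferGap
open Summit.QuantumFields.YangMills.Theorems.FemtoTransferGap.TT
open Summit.QuantumFields.YangMills.Theorems.VirialFluxGap.RingDeficit
open Summit.QuantumFields.YangMills.Theorems.SwapVirialDeficit.SwapRing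
open Summit.QuantumFields.YangMills.Theorems.SwapVirialDeficit.BlowUpRing
open Summit.QuantumFields.YangMills.Theorems.QuantitativeLaplace (iteratedFDeriv_two_eq_lineJet)

variable {L : ℕ} [NeZero L]

/-- The RAY identity of a follower-Hessian family from its FIBRE FORM identity (I1's `hFyy`). [folklore] -/
theorem folRay_of_fibreForm {a : ℍ} (ha : a ≠ 0) (ε : GnoSign L) {AF : GnoCoord L → GnoFol L →ₗ[ℝ] GnoFol L}
    (hFyy : ∀ η (y : GnoFol L), ⟪AF η y, y⟫_ℝ =
      iteratedFDeriv ℝ 2 (fun y' : GnoFol L => gnoDeficit (fun _ => false) (fun _ => 1) a ε (η + gnoFolEmb y')) 0 (fun _ => y))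
    (η : GnoCoord L) (y : GnoFol L) :
    ⟪AF η y, y⟫_ℝ = iteratedDeriv 2 (fun s : ℝ => gnoDeficit (fun _ => false) (fun _ => 1) a ε (η + s • gnoFolEmb y)) 0 := by
  rw [hFyy, iteratedFDeriv_two_eq_lineJet (contDiff_gnoDeficit_fol (n := 2) _ _ ha ε η) 0 y, gnoDeficit_fol_ray, map_zero, add_zero]

/-- ★ `‖gnoBase p − gnoBase p′‖ ≤ dist p p′` (sup norms on the letters, sup metric on the base plane). [folklore] -/
theorem norm_gnoBase_sub_le (p p' : ℝ × ℝ) : ‖(gnoBase p.1 p.2 : GnoCoord L) - gnoBase p'.1 p'.2‖ ≤ dist p p' := by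
  have hd1 : |p.1 - p'.1| ≤ dist p p' := by rw [← Real.dist_eq, Prod.dist_eq]; exact le_max_left _ _
  have hd2 : |p.2 - p'.2| ≤ dist p p' := by rw [← Real.dist_eq, Prod.dist_eq]; exact le_max_right _ _
  have hd0 : 0 ≤ dist p p' := dist_nonneg
  have e : (gnoBase p.1 p.2 : GnoCoord L) - gnoBase p'.1 p'.2 =
      ((((![p.1 - p'.1, 0, 0] : Fin 3 → ℝ), (![p.2 - p'.2, 0, 0] : Fin 3 → ℝ)), ((0 : Fin 3 → ℝ), (0 : Fol L → Fin 3 → ℝ))) : GnoCoord L) := by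
    unfold gnoBase
    refine Prod.ext (Prod.ext ?_ ?_) (Prod.ext ?_ ?_)
    · funext i; fin_cases i <;> simp
    · funext i; fin_cases i <;> simp
    · simp
    · simp
  rw [e]
  have hx : ‖(![p.1 - p'.1, 0, 0] : Fin 3 → ℝ)‖ ≤ dist p p' := by
    refine (pi_norm_le_iff_of_nonneg hd0).2 fun i => ?_
    fin_cases i
    · simpa using hd1
    · simp [hd0]
    · simp [hd0]
  have hy : ‖(![p.2 - p'.2, 0, 0] : Fin 3 → ℝ)‖ ≤ dist p p' := by
    refine (pi_norm_le_iff_of_nonneg hd0).2 fun i => ?_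
    fin_cases i
    · simpa using hd2
    · simp [hd0]
    · simp [hd0]
  rw [Prod.norm_def, Prod.norm_def, Prod.norm_def]
  refine max_le (max_le hx hy) (max_le ?_ ?_)
  · simp [hd0]
  · simp [hd0]

/-- ★★ **(I4) BALL-CONSTANCY OF THE REFERENCE ONE-LOOP WEIGHT**: for the reference family `AF` at `hubAt 0 1` (good signs) and base points at sup-distance
`< μ_F∕(3|Fol L|·44712000·L⁴)`: `(√det AF(gnoBase p))⁻¹ ≤ e · (√det AF(gnoBase p′))⁻¹` (✓`abs_log_det_gnoFolHessian_sub_le_joint` at one hub, ✓`gnoFolHessian_coercive_base`). [cite: Breitung1994, Lemma 26] -/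
theorem D_ball_const {ε : GnoSign L} (hε : GoodSign ε) {AF : GnoCoord L → GnoFol L →ₗ[ℝ] GnoFol L} (hFs : ∀ η, (AF η).IsSymmetric)
    (hFyy : ∀ η (y : GnoFol L), ⟪AF η y, y⟫_ℝ =
      iteratedFDeriv ℝ 2 (fun y' : GnoFol L => gnoDeficit (fun _ => false) (fun _ => 1) (hubAt 0 1) ε (η + gnoFolEmb y')) 0 (fun _ => y))
    (hamb : ∀ η (y : GnoFol L), ⟪AF η y, y⟫_ℝ = iteratedFDeriv ℝ 2 (gnoDeficit (fun _ => false) (fun _ => 1) (hubAt 0 1) ε) η (fun _ => gnoFolEmb y))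
    {p p' : ℝ × ℝ} (hd : dist p p' < (2304 * (L : ℝ) ^ 6 * (Fintype.card (Fol L) : ℝ))⁻¹ / (3 * (Fintype.card (Fol L) : ℝ) * 44712000 * (L : ℝ) ^ 4)) :
    ENNReal.ofReal ((Real.sqrt (LinearMap.det (AF (gnoBase p.1 p.2))))⁻¹) ≤
      ENNReal.ofReal (Real.exp 1) * ENNReal.ofReal ((Real.sqrt (LinearMap.det (AF (gnoBase p'.1 p'.2))))⁻¹) := by
  set μ : ℝ := (2304 * (L : ℝ) ^ 6 * (Fintype.card (Fol L) : ℝ))⁻¹ with hμ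
  have hμ0 : 0 < μ := (folMu_pos_le (L := L)).1
  have hL : (0 : ℝ) < L := by exact_mod_cast NeZero.pos L
  have hc1 : (1 : ℝ) ≤ Fintype.card (Fol L) := by exact_mod_cast one_le_card_fol (L := L)
  have hray := folRay_of_fibreForm (L := L) (hubAt_one_ne_zero 0) ε hFyy
  -- both determinants positive
  have hdet : μ ^ finrank ℝ (GnoFol L) ≤ LinearMap.det (AF (gnoBase p.1 p.2)) := det_gnoFolHessian_base_ge (hubAt_one_ne_zero 0) ε hε.1 hε.2 p.1 p.2 hFs hray
  have hdet' : μ ^ finrank ℝ (GnoFol L) ≤ LinearMap.det (AF (gnoBase p'.1 p'.2)) := det_gnoFolHessian_base_ge (hubAt_one_ne_zero 0) ε hε.1 hε.2 p'.1 p'.2 hFs hray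
  have hdpos : 0 < LinearMap.det (AF (gnoBase p.1 p.2)) := lt_of_lt_of_le (by positivity) hdet
  have hdpos' : 0 < LinearMap.det (AF (gnoBase p'.1 p'.2)) := lt_of_lt_of_le (by positivity) hdet'
  -- the joint lemma at one hub angle
  have eθ : gnoDeficit (fun _ => false) (fun _ => (1 : SU2)) (hubAt 0 1) ε = gnoDeficit (fun _ => false) (fun _ => 1) (angUnit (Real.pi / 2 - Real.arctan 0)) ε :=
    funext fun η => gnoDeficit_hubAt_eq_angUnit _ _ 0 ε η
  have hambθ : ∀ η (y : GnoFol L), ⟪AF η y, y⟫_ℝ = iteratedFDeriv ℝ 2 (gnoDeficit (fun _ => false) (fun _ => 1) (angUnit (Real.pi / 2 - Real.arctan 0)) ε) η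
      (fun _ => gnoFolEmb y) := fun η y => by rw [← eθ]; exact hamb η y
  have hdist := norm_gnoBase_sub_le (L := L) p p'
  have hd0 : 0 ≤ dist p p' := dist_nonneg
  have hden : 0 < 3 * (Fintype.card (Fol L) : ℝ) * 44712000 * (L : ℝ) ^ 4 := by positivity
  have hd' : dist p p' * (3 * (Fintype.card (Fol L) : ℝ) * 44712000 * (L : ℝ) ^ 4) ≤ μ := ((lt_div_iff₀ hden).1 hd).le
  have hnear : (122689728 * |(Real.pi / 2 - Real.arctan 0) - (Real.pi / 2 - Real.arctan 0)| +
      44712000 * ‖(gnoBase p.1 p.2 : GnoCoord L) - gnoBase p'.1 p'.2‖) * (L : ℝ) ^ 4 ≤ μ / 2 := by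
    rw [sub_self, abs_zero, mul_zero, zero_add]
    have h1 : 44712000 * ‖(gnoBase p.1 p.2 : GnoCoord L) - gnoBase p'.1 p'.2‖ * (L : ℝ) ^ 4 ≤ 44712000 * dist p p' * (L : ℝ) ^ 4 := by gcongr
    nlinarith [hd', hc1, hd0, pow_pos hL 4]
  have hlog := abs_log_det_gnoFolHessian_sub_le_joint (fun _ => false) (fun _ => (1 : SU2)) (sin_hubAngle_pos 0).le (sin_hubAngle_pos 0).le ε hFs hFs
    hambθ hambθ hμ0 (gnoFolHessian_coercive_base (hubAt_one_ne_zero 0) ε hε.1 hε.2 p'.1 p'.2 hray) hnear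
  rw [sub_self, abs_zero, mul_zero, zero_add] at hlog
  have hlog2 : |Real.log (LinearMap.det (AF (gnoBase p.1 p.2))) - Real.log (LinearMap.det (AF (gnoBase p'.1 p'.2)))| ≤ 2 := by
    refine hlog.trans ?_
    rw [div_le_iff₀ hμ0]
    have h1 : 44712000 * ‖(gnoBase p.1 p.2 : GnoCoord L) - gnoBase p'.1 p'.2‖ * (L : ℝ) ^ 4 ≤ 44712000 * dist p p' * (L : ℝ) ^ 4 := by gcongr
    nlinarith [hd', hc1, hd0, pow_pos hL 4, norm_nonneg ((gnoBase p.1 p.2 : GnoCoord L) - gnoBase p'.1 p'.2)]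
  -- `(√det p)⁻¹ ≤ e · (√det p′)⁻¹`
  have hkey : (Real.sqrt (LinearMap.det (AF (gnoBase p.1 p.2))))⁻¹ ≤ Real.exp 1 * (Real.sqrt (LinearMap.det (AF (gnoBase p'.1 p'.2))))⁻¹ := by
    have e1 : (Real.sqrt (LinearMap.det (AF (gnoBase p.1 p.2))))⁻¹ = Real.exp (-(Real.log (LinearMap.det (AF (gnoBase p.1 p.2))) / 2)) := by
      rw [Real.sqrt_eq_rpow, Real.rpow_def_of_pos hdpos, ← Real.exp_neg]; ring_nf
    have e2 : Real.exp 1 * (Real.sqrt (LinearMap.det (AF (gnoBase p'.1 p'.2))))⁻¹ = Real.exp (1 + -(Real.log (LinearMap.det (AF (gnoBase p'.1 p'.2))) / 2)) := by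
      rw [Real.sqrt_eq_rpow, Real.rpow_def_of_pos hdpos', ← Real.exp_neg, ← Real.exp_add]; ring_nf
    rw [e1, e2, Real.exp_le_exp]
    have h2 := (abs_le.1 hlog2).1
    linarith
  calc ENNReal.ofReal ((Real.sqrt (LinearMap.det (AF (gnoBase p.1 p.2))))⁻¹)
      ≤ ENNReal.ofReal (Real.exp 1 * (Real.sqrt (LinearMap.det (AF (gnoBase p'.1 p'.2))))⁻¹) := ENNReal.ofReal_le_ofReal hkey
    _ = ENNReal.ofReal (Real.exp 1) * ENNReal.ofReal ((Real.sqrt (LinearMap.det (AF (gnoBase p'.1 p'.2))))⁻¹) := ENNReal.ofReal_mul (Real.exp_pos 1).le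

/-- ★★★ **THE SHELL SIDE (δ) IN THE INTERFACE SHAPE (I1)–(I2)**: reference family by `(hFs, hFyy, hamb)` at `hubAt 0 1`, integrand `D p * ofReal(w p)` with
`D p = ofReal((√det AF(gnoBase p))⁻¹)`, `w(p) = (1+x₀²)⁻¹(1+y₀²)⁻¹`; `0 < r ≤ 1`, `122689728·r·L⁴ ≤ μ_F∕2`; constant as in ✓`endGauss_shell_ge`. [cite: Luscher1983, §2] -/
theorem endGauss_shell_ge_D {ε : GnoSign L} (hε : GoodSign ε) {AF : GnoCoord L → GnoFol L →ₗ[ℝ] GnoFol L} (hFs : ∀ η, (AF η).IsSymmetric)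
    (hFyy : ∀ η (y : GnoFol L), ⟪AF η y, y⟫_ℝ =
      iteratedFDeriv ℝ 2 (fun y' : GnoFol L => gnoDeficit (fun _ => false) (fun _ => 1) (hubAt 0 1) ε (η + gnoFolEmb y')) 0 (fun _ => y))
    (hamb : ∀ η (y : GnoFol L), ⟪AF η y, y⟫_ℝ = iteratedFDeriv ℝ 2 (gnoDeficit (fun _ => false) (fun _ => 1) (hubAt 0 1) ε) η (fun _ => gnoFolEmb y))
    {r : ℝ} (hr0 : 0 < r) (hr1 : r ≤ 1) (hr : 122689728 * r * (L : ℝ) ^ 4 ≤ (2304 * (L : ℝ) ^ 6 * (Fintype.card (Fol L) : ℝ))⁻¹ / 2) :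
    ∫⁻ p : ℝ × ℝ, ENNReal.ofReal ((Real.sqrt (LinearMap.det (AF (gnoBase p.1 p.2))))⁻¹) * ENNReal.ofReal ((1 + p.1 ^ 2)⁻¹ * (1 + p.2 ^ 2)⁻¹) ≤
      ENNReal.ofReal ((((1 + (finrank ℝ (GnoFol L) : ℝ)) * (20400 * (L : ℝ) ^ 4)) ^ (7 / 2 : ℝ) * Real.exp (1 / 2 : ℝ) *
          Real.exp ((3 * (Fintype.card (Fol L) : ℝ)) * (122689728 * r * (L : ℝ) ^ 4) / (2304 * (L : ℝ) ^ 6 * (Fintype.card (Fol L) : ℝ))⁻¹)) * (8 / r)) *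
        ENNReal.ofReal (∫ δ' in Icc (r / 2) r, ((1 + δ' ^ 2)⁻¹) ^ 2 * ∫ p : ℝ × ℝ, mbDensity (L := L) (hubAt δ' 1) ε p) := by
  have hray := folRay_of_fibreForm (L := L) (hubAt_one_ne_zero 0) ε hFyy
  have h := endGauss_shell_ge (L := L) hε hFs hamb hray hr0 hr1 hr
  refine le_trans (le_of_eq (lintegral_congr fun p => ?_)) h
  rw [← ENNReal.ofReal_mul (inv_nonneg.2 (Real.sqrt_nonneg _)), div_eq_inv_mul, mul_comm]

end Summit.QuantumFields.YangMills.Theorems.SwapVirialDeficit.SectorLaplace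

end
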